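import Summits.QuantumAdvantage.QuantumAdvantage.Theorems.HankelLiftBeyondRectanglesDefs
import Summits.QuantumAdvantage.QuantumAdvantage.Theorems.HankelLiftLiouvilleSumMemBQP
import HarnessLib

/-!
# Route HankelLift, crux `BeyondRectangles` (stmt-QuantumAdvantage-18440): the registered stub
# `stub_successCalibration`, by name and signature

The registered skeleton `Cruxes/BeyondRectangles/Lines/birth.lean` (sha `f6a15a6c0aead5bb`) cuts the
hypothesis-type crux `HankelLift.BeyondRectangles` into `stub_liouvilleBPPDark` (hardness, OPEN),
`stub_antidiagonalSampling` (complexity glue) and `stub_successCalibration` (probability glue).  This file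
proves the third one VERBATIM over the objects of `HankelLiftBeyondRectanglesDefs.lean` (p555913):

  `stub_successCalibration : ∀ A n, successSum A n = 4ⁿ/2 − pairCorr A n / 2`

— for EVERY randomized `A` (no efficiency hypothesis) and every level `n`, the total probability that `A`
outputs the bit `[enc n x y ∈ L⁺]` over the `4ⁿ` pairs is `4ⁿ/2` minus half the PAIR correlation
`Σ λ(x+y+2)·(2·Pr[A = true] − 1)`.  Ingredients: the encoding is faithful on `[2ⁿ]²`
(`enc_mem_liftLang_iff`: `boolPair` is injective, the block length fixes `n`, fixed-width bit blocks are
injective below `2ⁿ` via `HankelLift.bitsToNat_ofFn_testBit`), `Pr[A = false] = 1 − Pr[A = true]`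
(`RandAlg.pr_ne_eq_one_sub`), and `λ(N) ∈ {±1}` for `N ≠ 0` (`ArithmeticFunction.liouville_apply`, inline).

WHAT THIS IS NOT: not a proof of the crux (its load-bearing stub `stub_liouvilleBPPDark` =
`LiouvilleBPPDark` is an open, hypothesis-type statement); pure finite probability bookkeeping.
-/

-- the sub-problem namespace `Summit.QuantumAdvantage.QuantumAdvantage` repeats the summit name by design (D-0017)
set_option linter.dupNamespace false

noncomputable section

namespace Summit.QuantumAdvantage.QuantumAdvantage.Theorems.BeyondRectangles

open scoped BigOperators Classical
open Literature.Computability.Complexity (RandAlg boolPair boolPair_injective bitsToNat)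

/-! ### Counting and the sign pattern -/

/-- `#([2ⁿ] × [2ⁿ]) = 4ⁿ`. [folklore] -/
theorem card_pairs (n : ℕ) : (Finset.univ : Finset (Fin (2 ^ n) × Fin (2 ^ n))).card = 4 ^ n := by
  rw [Finset.card_univ, Fintype.card_prod, Fintype.card_fin, ← mul_pow]
  norm_num

/-- Fixed-width bit blocks are injective below `2ⁿ`. [folklore] -/
theorem eq_of_ofFn_testBit_eq {n x x' : ℕ} (hx : x < 2 ^ n) (hx' : x' < 2 ^ n)
    (h : (List.ofFn fun i : Fin n => Nat.testBit x i) = List.ofFn fun i : Fin n => Nat.testBit x' i) :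
    x = x' := by
  have h' := congrArg bitsToNat h
  rwa [HankelLift.bitsToNat_ofFn_testBit hx, HankelLift.bitsToNat_ofFn_testBit hx'] at h'

/-- **The encoding is faithful**: for `x, y < 2ⁿ`, `enc n x y ∈ L⁺ ↔ λ(x + y + 2) = −1`. [folklore] -/
theorem enc_mem_liftLang_iff {n x y : ℕ} (hx : x < 2 ^ n) (hy : y < 2 ^ n) :
    enc n x y ∈ liftLang ↔ ArithmeticFunction.liouville (x + y + 2) = -1 := by
  constructor
  · rintro ⟨n', x', y', hx', hy', he, hl⟩
    have he' : ((List.ofFn fun i : Fin n => Nat.testBit x i), (List.ofFn fun i : Fin n => Nat.testBit y i)) =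
        ((List.ofFn fun i : Fin n' => Nat.testBit x' i), (List.ofFn fun i : Fin n' => Nat.testBit y' i)) :=
      boolPair_injective he
    obtain ⟨h1, h2⟩ := Prod.mk.inj he'
    have hn : n = n' := by
      have hl := congrArg List.length h1
      rwa [List.length_ofFn, List.length_ofFn] at hl
    subst hn
    rw [eq_of_ofFn_testBit_eq hx hx' h1, eq_of_ofFn_testBit_eq hy hy' h2]
    exact hl
  · intro h
    exact ⟨n, x, y, hx, hy, rfl, h⟩

/-- The target bit of the crux is the Hankel sign bit: `[enc n x y ∈ L⁺] = [λ(x+y+2) = −1]`. [folklore] -/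
theorem boolIndicator_liftLang_enc (n : ℕ) (p : Fin (2 ^ n) × Fin (2 ^ n)) :
    Set.boolIndicator liftLang (enc n p.1 p.2) =
      decide (ArithmeticFunction.liouville (p.1.val + p.2.val + 2) = -1) := by
  have h := enc_mem_liftLang_iff (n := n) p.1.isLt p.2.isLt
  by_cases hm : enc n p.1 p.2 ∈ liftLang
  · rw [(Set.mem_iff_boolIndicator _ _).1 hm, eq_comm, decide_eq_true_iff]
    exact h.1 hm
  · rw [(Set.notMem_iff_boolIndicator _ _).1 hm, eq_comm, decide_eq_false_iff_not]
    exact fun h' => hm (h.2 h')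

/-- **Per-pair calibration**: `Pr[A correct on (x,y)] = 1/2 − λ(x+y+2)·(2·t_A(x,y) − 1)/2`. [folklore] -/
theorem pr_correct_eq (A : RandAlg (List Bool) Bool) (n : ℕ) (p : Fin (2 ^ n) × Fin (2 ^ n)) :
    A.pr id (enc n p.1 p.2) {Set.boolIndicator liftLang (enc n p.1 p.2)} =
      1 / 2 - hankelSign n p * (2 * accept A n p - 1) / 2 := by
  rw [boolIndicator_liftLang_enc]
  unfold hankelSign accept
  have hN : p.1.val + p.2.val + 2 ≠ 0 := by omega
  -- `λ(N) = (−1)^{Ω(N)} ∈ {±1}` (as in `MobiusLadder.liouville_eq_one_or_eq_neg_one`, re-derived inline to avoid a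
  -- second route cone)
  have hl : ArithmeticFunction.liouville (p.1.val + p.2.val + 2) = 1 ∨
      ArithmeticFunction.liouville (p.1.val + p.2.val + 2) = -1 := by
    rw [ArithmeticFunction.liouville_apply hN]; exact neg_one_pow_eq_or ℤ _
  rcases hl with h | h
  · have hdec : decide (ArithmeticFunction.liouville (p.1.val + p.2.val + 2) = -1) = false := by
      rw [h]; decide
    rw [hdec, h]
    have hc := RandAlg.pr_ne_eq_one_sub A id (enc n p.1 p.2) true
    have hset : ({b : Bool | b ≠ true} : Set Bool) = {false} := by
      ext b; cases b <;> simp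
    rw [hset] at hc
    rw [hc]
    push_cast
    ring
  · have hdec : decide (ArithmeticFunction.liouville (p.1.val + p.2.val + 2) = -1) = true := by
      rw [h]; decide
    rw [hdec, h]
    push_cast
    ring

/-! ### The stub -/

/-- **`stub_successCalibration` (registered name and signature)**: for every randomized `A` and every level
`n`, `successSum A n = 4ⁿ/2 − pairCorr A n / 2` — sum the per-pair calibration `pr_correct_eq` over the `4ⁿ`
pairs. [cite: BogdanovTrevisan2006, Def. 2.13] -/
theorem stub_successCalibration :
    ∀ (A : RandAlg (List Bool) Bool) (n : ℕ), successSum A n = (4 : ℝ) ^ n / 2 - pairCorr A n / 2 := by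
  intro A n
  unfold successSum pairCorr
  rw [Finset.sum_congr rfl fun p _ => pr_correct_eq A n p, Finset.sum_sub_distrib,
    Finset.sum_const, card_pairs, ← Finset.sum_div]
  simp only [nsmul_eq_mul]
  push_cast
  ring

end Summit.QuantumAdvantage.QuantumAdvantage.Theorems.BeyondRectangles

end
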